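import Summits.ABC.StewartYu.PadicG3ParN
import Summits.ABC.StewartYu.PadicG3ParVF
import Summits.ABC.StewartYu.PadicG3ParGPowG
import HarnessLib

/-!
# The `𝔑`-threaded `p`-adic Gen-3 record `PadicG3ParN` — (B1) THE SIEGEL COUNT OVER `𝔑`, and `gⁿ ≤ K` at every `m`

Support file (elementary theorems; no named facts). Cell `abc-stewartyu`, route `YuMatveevShapeRat`, crux
`PadicCoreOddRat` (stmt-ABC-20503); seat p1 (record owner). Continues `PadicG3ParN`.

* **`pow_g_le_K_of_m_pos` / `pow_g_le_K`**: the excess gain satisfies `gⁿ ≤ K` at EVERY depth `m` (at `m ≥ 1`,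
  `g ≤ 1 + 3 log p/(8(n+1))` so `gⁿ ≤ p^{3/8} ≤ p ≤ p^m ≤ K`; at `m = 0` it is lp-1's `pow_g_le_K_of_m_zero'`), so the
  v2 END record's hypothesis `hgK` and the box facts below hold on both branches of the `N`-frame.
* the box is wide in EVERY coordinate: `24·C_bⁿ·Ω ≤ LV` (`hgK`), hence `LV/Aⱼ ≥ 48·32ⁿ` and
  **`(23/32)·(LV/Aⱼ) ≤ 2·sideV j`** (the `𝔑`-count has `2·sideⱼ` values per coordinate, not `2·sideⱼ + 1`);
* **(B1N)** `2·(2·XsV 0 + 1)·C(M′+n, n)·K ≤ (L₀N + 1)·N·∏ⱼ (2·sideV j)` for every order bound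
  `M′ + n ≤ (69/4)(n+1)·LgV` — the unknowns are the `(L₀N+1)·#(𝔑 ∩ box) ≥ (L₀N+1)·N·∏(2 sideV j)` coefficients
  (tree N1 `Dioph.exists_finset_lattice_box`), the equations as in v2; the degree `L₀N = ⌈6XV·C_bⁿΩK/(g^{n−1}N)⌉`
  gives back EXACTLY v2's main term (`N·L₀N ≥ 6XV·C_bⁿΩK/g^{n−1}`), and `C_b·(23/32) = 23e` replaces v2's
  `C_b·(3/4) = 24e` in the per-coordinate comparison `(69/4)·e·LgV ≤ 23e·(LgV − 1)` (`LgV ≥ 4`).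

## References
* [Nesterenko2003] Yu. V. Nesterenko, LNM 1819 (2003) — §3.3 Prop 3.4 (count in `𝔑`), §3.5 Prop 3.9 (3.48).
* [Yu2013] K. Yu, Acta Math. 211 (2013) — §3.1 (3.5).
-/

noncomputable section

open Finset Real

namespace Summit.ABC.StewartYu

namespace PadicG3Par

variable {n : ℕ} (P : PadicG3Par n)

/-- **`1 ≤ m ⟹ gⁿ ≤ K`**: at positive depth `g ≤ 1 + 3 log p/(8(n+1))`, so `gⁿ ≤ e^{3n·log p/(8(n+1))} ≤ p ≤ p^m ≤ K`.
[cite: Yu2013, §3.1 (3.5)] -/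
theorem pow_g_le_K_of_m_pos (hm : 1 ≤ P.m) : P.g ^ n ≤ (P.K : ℝ) := by
  have hlog := P.log_p_pos
  have hp1 : (1 : ℝ) < P.p := by linarith [P.two_le_p]
  have hg1 := P.one_le_g
  have hG := P.G_le
  have hθ := P.hθ₀2
  -- `g ≤ 1 + x`, `x = 3 log p/(8(n+1))`
  obtain ⟨x, hx⟩ : ∃ x : ℝ, x = 3 * Real.log P.p / (8 * (n + 1)) := ⟨_, rfl⟩
  have hx0 : 0 ≤ x := by rw [hx]; positivity
  have hgx : P.g ≤ 1 + x := by
    unfold g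
    rw [div_le_iff₀ (by unfold cG; positivity), hx]
    unfold cG at hG ⊢
    have h3 : (P.θ₀ + 1) * Real.log P.p ≤ 3 * Real.log P.p := by nlinarith
    have e : (1 + 3 * Real.log P.p / (8 * ((n : ℝ) + 1))) * (8 * ((n : ℝ) + 1)) =
        8 * ((n : ℝ) + 1) + 3 * Real.log P.p := by
      field_simp
    rw [e]; linarith
  -- `gⁿ ≤ (1+x)ⁿ ≤ exp(x)ⁿ = exp(n x) ≤ exp(log p) = p`
  have hnx : (n : ℝ) * x ≤ Real.log P.p := by
    rw [hx]
    have hn : (0 : ℝ) ≤ n := by positivity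
    rw [show (n : ℝ) * (3 * Real.log P.p / (8 * (n + 1))) = Real.log P.p * (3 * n / (8 * (n + 1))) by ring]
    have h38 : 3 * (n : ℝ) / (8 * (n + 1)) ≤ 1 := by
      rw [div_le_one (by positivity)]; linarith
    nlinarith
  have h1 : P.g ^ n ≤ (1 + x) ^ n := pow_le_pow_left₀ (by linarith) hgx n
  have h2 : (1 + x) ^ n ≤ Real.exp x ^ n :=
    pow_le_pow_left₀ (by linarith) (by have := Real.add_one_le_exp x; linarith) n
  have h3 : Real.exp x ^ n = Real.exp (n * x) := by rw [← Real.exp_nat_mul]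
  have h4 : Real.exp (n * x) ≤ P.p := by
    calc Real.exp (n * x) ≤ Real.exp (Real.log P.p) := Real.exp_le_exp.mpr hnx
      _ = P.p := Real.exp_log (by linarith)
  -- `p ≤ p^m ≤ K`
  have h5 : (P.p : ℝ) ≤ P.K := by
    unfold K; push_cast
    have hK₀ : (1 : ℝ) ≤ P.K₀ := by exact_mod_cast P.hK₀
    have hpm : (P.p : ℝ) ≤ (P.p : ℝ) ^ P.m := by
      calc (P.p : ℝ) = (P.p : ℝ) ^ 1 := (pow_one _).symm
        _ ≤ (P.p : ℝ) ^ P.m := pow_le_pow_right₀ hp1.le hm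
    have h0 : (0 : ℝ) ≤ (P.p : ℝ) ^ P.m := by positivity
    nlinarith
  calc P.g ^ n ≤ (1 + x) ^ n := h1
    _ ≤ Real.exp x ^ n := h2
    _ = Real.exp (n * x) := h3
    _ ≤ P.p := h4
    _ ≤ P.K := h5

/-- **`gⁿ ≤ K` at every depth** (`p ≥ 3`, `K₀ ≥ p − 1`). [cite: Yu2013, §3.1 (3.5)] -/
theorem pow_g_le_K (hp3 : 3 ≤ P.p) (hK₀ : (P.p : ℝ) - 1 ≤ P.K₀) : P.g ^ n ≤ (P.K : ℝ) := by
  by_cases hm : P.m = 0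
  · exact P.pow_g_le_K_of_m_zero' hm hp3 hK₀
  · exact P.pow_g_le_K_of_m_pos (by omega)

/-- **`24·C_bⁿ·Ω ≤ LV`** under `gⁿ ≤ K` (from `24 C_bⁿ Ω K/gⁿ ≤ LgV ≤ LV`). [cite: Nesterenko2003, §3.5 (3.23)] -/
theorem core_Ω_le_LV (hgK : P.g ^ n ≤ (P.K : ℝ)) : 24 * Cb ^ n * P.Ω ≤ P.LV := by
  have hcore := P.core_le_LgV
  have hg0 : 0 < P.g := lt_of_lt_of_le one_pos P.one_le_g
  have hgn : 0 < P.g ^ n := pow_pos hg0 n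
  have hK : 0 < (P.K : ℝ) := P.K_pos
  have hL : (0 : ℝ) ≤ P.LgV := by positivity
  have hLL : (P.LgV : ℝ) ≤ P.LV := by exact_mod_cast P.LgV_le_LV
  rw [div_le_iff₀ hgn] at hcore
  have h1 : (P.LgV : ℝ) * P.g ^ n ≤ P.LgV * P.K := mul_le_mul_of_nonneg_left hgK hL
  have h2 : 24 * Cb ^ n * P.Ω * P.K ≤ P.LV * P.K := (hcore.trans h1).trans (by nlinarith)
  exact le_of_mul_le_mul_right h2 hK

/-- `48·32ⁿ·Aⱼ ≤ LV` under `gⁿ ≤ K` (as `Ω ≥ Aⱼ·(log 2)^{n−1} ≥ Aⱼ/2^{n−1}` and `C_b ≥ 64`). [folklore] -/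
theorem A_mul_le_LV (hgK : P.g ^ n ≤ (P.K : ℝ)) (j : Fin n) : 48 * 32 ^ n * P.A j ≤ P.LV := by
  have h := P.core_Ω_le_LV hgK
  have hCb := sixtyfour_le_Cb
  have hA := P.A_pos j
  -- `Ω ≥ A j · (1/2)^{n-1}`: all other weights are `≥ log 2 > 1/2`
  have hΩ : P.A j * (1 / 2) ^ (n - 1) ≤ P.Ω := by
    unfold Ω
    rw [← Finset.mul_prod_erase Finset.univ P.A (Finset.mem_univ j)]
    refine mul_le_mul_of_nonneg_left ?_ hA.le
    have hcard : (Finset.univ.erase j).card = n - 1 := by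
      rw [Finset.card_erase_of_mem (Finset.mem_univ j), Finset.card_univ, Fintype.card_fin]
    calc ((1 : ℝ) / 2) ^ (n - 1) = ∏ _i ∈ Finset.univ.erase j, ((1 : ℝ) / 2) := by
          rw [Finset.prod_const, hcard]
      _ ≤ ∏ i ∈ Finset.univ.erase j, P.A i :=
          Finset.prod_le_prod (fun _ _ => by norm_num) fun i _ => by
            have := P.hA i; have := Real.log_two_gt_d9; linarith
  have hn := P.hn
  -- `24 Cbⁿ (1/2)^{n-1} ≥ 24·64ⁿ·2^{1-n} = 48·32ⁿ`
  have hpow : (48 : ℝ) * 32 ^ n ≤ 24 * Cb ^ n * (1 / 2) ^ (n - 1) := by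
    have e : (24 : ℝ) * 64 ^ n * (1 / 2) ^ (n - 1) = 48 * 32 ^ n := by
      obtain ⟨k, hk⟩ : ∃ k, n = k + 1 := ⟨n - 1, by omega⟩
      subst hk
      simp only [Nat.add_sub_cancel, pow_succ]
      rw [show (64 : ℝ) ^ k = 32 ^ k * 2 ^ k by rw [← mul_pow]; norm_num]
      have h2k : (2 : ℝ) ^ k * (1 / 2) ^ k = 1 := by rw [← mul_pow]; norm_num
      calc (24 : ℝ) * (32 ^ k * 2 ^ k * 64) * (1 / 2) ^ k = 24 * 64 * 32 ^ k * (2 ^ k * (1 / 2) ^ k) := by ring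
        _ = 48 * (32 ^ k * 32) := by rw [h2k]; ring
    rw [← e]
    have h64 : (64 : ℝ) ^ n ≤ Cb ^ n := pow_le_pow_left₀ (by norm_num) hCb n
    have h0 : (0 : ℝ) ≤ (1 / 2) ^ (n - 1) := by positivity
    nlinarith [mul_le_mul_of_nonneg_right h64 h0]
  have hC0 : (0 : ℝ) ≤ 24 * Cb ^ n := by positivity
  calc 48 * 32 ^ n * P.A j ≤ 24 * Cb ^ n * (1 / 2) ^ (n - 1) * P.A j :=
        mul_le_mul_of_nonneg_right hpow hA.le
    _ = 24 * Cb ^ n * (P.A j * (1 / 2) ^ (n - 1)) := by ring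
    _ ≤ 24 * Cb ^ n * P.Ω := mul_le_mul_of_nonneg_left hΩ hC0
    _ ≤ P.LV := h

/-- **`(23/32)·(LV/Aⱼ) ≤ 2·sideV j`** under `gⁿ ≤ K` (the box has `≥ 768` steps per coordinate, so dropping the
`+1` of the `ℤⁿ`-count costs `< 1/768` per coordinate). [cite: Nesterenko2003, §3.3 Prop 3.4] -/
theorem two_sideV_ge (hgK : P.g ^ n ≤ (P.K : ℝ)) (j : Fin n) :
    (23 / 32 : ℝ) * (P.LV / P.A j) ≤ 2 * (P.sideV j : ℝ) := by
  have hA := P.A_pos j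
  have hbig := P.A_mul_le_LV hgK j
  have h32 : (32 : ℝ) ≤ 32 ^ n := by
    calc (32 : ℝ) = 32 ^ 1 := by norm_num
      _ ≤ 32 ^ n := pow_le_pow_right₀ (by norm_num) P.hn
  have hq : (64 / 9 : ℝ) ≤ P.LV / P.A j := by
    rw [le_div_iff₀ hA]; nlinarith
  -- `sideV j > LV/(2 A j) − 1`
  have hs : (P.LV : ℝ) / (2 * P.A j) - 1 < P.sideV j := by
    have := Nat.lt_floor_add_one ((P.LV : ℝ) / (2 * P.A j))
    unfold sideV; linarith
  have e : (P.LV : ℝ) / (2 * P.A j) = (P.LV / P.A j) / 2 := by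
    rw [div_div, mul_comm]
  rw [e] at hs
  nlinarith

/-- **`(23/32)ⁿ·LVⁿ/Ω ≤ ∏ⱼ (2·sideV j)`** under `gⁿ ≤ K`. [cite: Nesterenko2003, §3.3 Prop 3.4] -/
theorem prod_two_sideV_ge (hgK : P.g ^ n ≤ (P.K : ℝ)) :
    (23 / 32 : ℝ) ^ n * ((P.LV : ℝ) ^ n / P.Ω) ≤ ∏ j, (2 * (P.sideV j : ℝ)) := by
  have h : ∀ j ∈ (Finset.univ : Finset (Fin n)), (23 / 32 : ℝ) * (P.LV / P.A j) ≤ 2 * (P.sideV j : ℝ) :=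
    fun j _ => P.two_sideV_ge hgK j
  have h0 : ∀ j ∈ (Finset.univ : Finset (Fin n)), (0 : ℝ) ≤ (23 / 32 : ℝ) * (P.LV / P.A j) :=
    fun j _ => by have := P.A_pos j; positivity
  have hprod := Finset.prod_le_prod h0 h
  have e : ∏ j, (23 / 32 : ℝ) * (P.LV / P.A j) = (23 / 32 : ℝ) ^ n * ((P.LV : ℝ) ^ n / P.Ω) := by
    rw [Finset.prod_mul_distrib, Finset.prod_const, Finset.card_univ, Fintype.card_fin,
      Finset.prod_div_distrib, Finset.prod_const, Finset.card_univ, Fintype.card_fin]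
    rfl
  rw [← e]; exact hprod

end PadicG3Par

namespace PadicG3ParN

open PadicG3Par (Cb cM cG Cb_pos choose_le_of_le)

variable {n : ℕ} (P : PadicG3ParN n)

/-- `6 XV C_bⁿ Ω K/g^{n−1} ≤ N·(L₀N + 1)` — the `𝔑`-count restores v2's degree main term. [folklore] -/
theorem main_le_N_mul_L0N_succ :
    6 * P.XV * Cb ^ n * P.Ω * P.K / P.g ^ (n - 1) ≤ (P.N : ℝ) * ((P.L0N : ℝ) + 1) := by
  have h := P.L0N_ge
  have hN := P.N_pos
  have hg : 0 < P.g ^ (n - 1) := pow_pos (lt_of_lt_of_le one_pos P.one_le_g) _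
  rw [div_le_iff₀ (by positivity)] at h
  rw [div_le_iff₀ hg]
  nlinarith

/-- **(B1N) THE SIEGEL COUNT OVER `𝔑`** (real form): for every order bound `M′ + n ≤ (69/4)(n+1)LgV` and under
`gⁿ ≤ K`, `2·(2·XsV 0 + 1)·C(M′+n, n)·K ≤ (L₀N + 1)·N·∏ⱼ (2·sideV j)`. [cite: Nesterenko2003, Prop 3.9 (3.48)] -/
theorem siegel_countN_real (hgK : P.g ^ n ≤ (P.K : ℝ)) {M' : ℕ}
    (hM : (M' : ℝ) + n ≤ (69 / 4) * (n + 1) * P.LgV) :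
    2 * (2 * (P.XsV 0 : ℝ) + 1) * (Nat.choose (M' + n) n : ℝ) * P.K ≤
      ((P.L0N : ℝ) + 1) * P.N * ∏ j, (2 * (P.sideV j : ℝ)) := by
  have hLg1 := P.one_le_LgV
  have hLg4 : (4 : ℝ) ≤ P.LgV := by
    have h1 : 4 ≤ 2 ^ (n + 25) := le_trans (by norm_num) (Nat.pow_le_pow_right (by norm_num) (show 2 ≤ n + 25 by omega))
    exact_mod_cast h1.trans P.two_pow_le_LgV
  have hC : (Nat.choose (M' + n) n : ℝ) ≤ ((69 / 4) * P.LgV * Real.exp 1) ^ n :=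
    choose_le_of_le M' (by positivity) (by linarith)
  have hprod := P.prod_two_sideV_ge hgK
  have hmain := P.main_le_N_mul_L0N_succ
  have hK := P.K_pos
  have hΩ := P.Ω_pos
  have hN := P.N_pos
  have hg1 := P.one_le_g
  have hg0 : 0 < P.g := by linarith
  have hgn : 0 < P.g ^ (n - 1) := pow_pos hg0 _
  have hX : (0 : ℝ) ≤ P.XV := by positivity
  have he : (0 : ℝ) ≤ Real.exp 1 := (Real.exp_pos 1).le
  have hCb : (0 : ℝ) < Cb := Cb_pos
  have hLV := P.g_mul_LgV_sub_one_le_LV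
  have hLV0 : (0 : ℝ) ≤ P.g * ((P.LgV : ℝ) - 1) := by nlinarith
  -- (1) unknowns ≥ `6 XV K (23 e)ⁿ LVⁿ / g^{n-1}`
  have e2 : Cb * (23 / 32) = 23 * Real.exp 1 := by unfold Cb cM; push_cast; ring
  have hprod0 : (0 : ℝ) ≤ ∏ j, (2 * (P.sideV j : ℝ)) := prod_nonneg fun j _ => by positivity
  have hR : 6 * P.XV * P.K * (23 * Real.exp 1) ^ n * (P.LV : ℝ) ^ n / P.g ^ (n - 1) ≤
      ((P.L0N : ℝ) + 1) * P.N * ∏ j, (2 * (P.sideV j : ℝ)) := by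
    have e : 6 * P.XV * Cb ^ n * P.Ω * P.K / P.g ^ (n - 1) * ((23 / 32 : ℝ) ^ n * ((P.LV : ℝ) ^ n / P.Ω)) =
        6 * P.XV * P.K * (23 * Real.exp 1) ^ n * (P.LV : ℝ) ^ n / P.g ^ (n - 1) := by
      rw [← e2, mul_pow]
      field_simp
    rw [← e]
    have h0 : 0 ≤ 6 * P.XV * Cb ^ n * P.Ω * P.K / P.g ^ (n - 1) := by positivity
    calc 6 * P.XV * Cb ^ n * P.Ω * P.K / P.g ^ (n - 1) * ((23 / 32 : ℝ) ^ n * ((P.LV : ℝ) ^ n / P.Ω))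
        ≤ ((P.N : ℝ) * ((P.L0N : ℝ) + 1)) * ∏ j, (2 * (P.sideV j : ℝ)) :=
          mul_le_mul hmain hprod (by positivity) (by positivity)
      _ = ((P.L0N : ℝ) + 1) * P.N * ∏ j, (2 * (P.sideV j : ℝ)) := by ring
  -- (2) `g (LgV - 1)ⁿ ≤ LVⁿ/g^{n-1}`
  have hpow : P.g * ((P.LgV : ℝ) - 1) ^ n ≤ (P.LV : ℝ) ^ n / P.g ^ (n - 1) := by
    have h1 : (P.g * ((P.LgV : ℝ) - 1)) ^ n ≤ (P.LV : ℝ) ^ n := pow_le_pow_left₀ hLV0 hLV n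
    rw [le_div_iff₀ hgn]
    have e4 : P.g * ((P.LgV : ℝ) - 1) ^ n * P.g ^ (n - 1) = (P.g * ((P.LgV : ℝ) - 1)) ^ n := by
      rw [mul_pow, P.pow_g_eq]; ring
    rw [e4]; exact h1
  -- (3) `(69/4) e LgV ≤ 23 e (LgV - 1)` (as `LgV ≥ 4`)
  have hbase : (69 / 4) * (P.LgV : ℝ) * Real.exp 1 ≤ 23 * Real.exp 1 * ((P.LgV : ℝ) - 1) := by
    nlinarith [Real.exp_pos 1]
  have hbase0 : 0 ≤ (69 / 4) * (P.LgV : ℝ) * Real.exp 1 := by positivity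
  have hpown : ((69 / 4) * (P.LgV : ℝ) * Real.exp 1) ^ n ≤ (23 * Real.exp 1 * ((P.LgV : ℝ) - 1)) ^ n :=
    pow_le_pow_left₀ hbase0 hbase n
  -- (4) assemble
  have hrange := P.eqs_range_le
  have hCpos : (0 : ℝ) ≤ (Nat.choose (M' + n) n : ℝ) := by positivity
  have hXs0 : (0 : ℝ) ≤ 2 * (2 * (P.XsV 0 : ℝ) + 1) := by positivity
  calc 2 * (2 * (P.XsV 0 : ℝ) + 1) * (Nat.choose (M' + n) n : ℝ) * P.K
      ≤ (6 * (P.g * P.XV)) * ((69 / 4) * (P.LgV : ℝ) * Real.exp 1) ^ n * P.K := by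
        gcongr
    _ ≤ (6 * (P.g * P.XV)) * (23 * Real.exp 1 * ((P.LgV : ℝ) - 1)) ^ n * P.K := by gcongr
    _ = 6 * P.XV * P.K * (23 * Real.exp 1) ^ n * (P.g * ((P.LgV : ℝ) - 1) ^ n) := by
        rw [mul_pow]; ring
    _ ≤ 6 * P.XV * P.K * (23 * Real.exp 1) ^ n * ((P.LV : ℝ) ^ n / P.g ^ (n - 1)) :=
        mul_le_mul_of_nonneg_left hpow (by positivity)
    _ = 6 * P.XV * P.K * (23 * Real.exp 1) ^ n * (P.LV : ℝ) ^ n / P.g ^ (n - 1) := by ring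
    _ ≤ _ := hR

/-- **(B1N) in natural numbers**: `2 (2 XsV 0 + 1) · C(M′+n, n) · K ≤ (L₀N + 1) · N · ∏ (2 sideV j)` whenever
`M′ + n ≤ (69/4)(n+1) LgV` and `gⁿ ≤ K`. [cite: Nesterenko2003, Prop 3.9 (3.48)] -/
theorem siegel_countN (hgK : P.g ^ n ≤ (P.K : ℝ)) {M' : ℕ} (hM : (M' : ℝ) + n ≤ (69 / 4) * (n + 1) * P.LgV) :
    2 * (2 * P.XsV 0 + 1) * Nat.choose (M' + n) n * P.K ≤ (P.L0N + 1) * P.N * ∏ j, (2 * P.sideV j) := by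
  have h := P.siegel_countN_real hgK hM
  exact_mod_cast h

/-- the level-0 order of the `N`-frame: **`MordN 0 0 + (n+1)(ŜN+1) + n ≤ (69/4)(n+1)LgV + 2(n+1)(ŜN − ŜG)`** under
`N_q = K` (v2's `(69/4)(n+1)LgV`, plus the longer floor phase paid twice: once in `RN 0`, once in the reserve).
[cite: Nesterenko2003, (3.25)] -/
theorem MordN_T0_le (hNq : P.Nq = P.K) :
    (P.MordN 0 0 : ℝ) + (n + 1) * (P.SdN + 1) + n ≤
      (69 / 4) * (n + 1) * P.LgV + 2 * (n + 1) * ((P.SdN : ℝ) - P.SdG) := by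
  have h1 : ((P.MordN 0 0 : ℕ) : ℝ) ≤ ((P.MV / (n + 2) ^ 3 + (n + 1) * (16 * P.LgV + (P.SdN + 1)) : ℕ) : ℝ) := by
    exact_mod_cast P.MordN_zero_zero_le
  have h2 : ((P.MV / (n + 2) ^ 3 : ℕ) : ℝ) ≤ (P.MV : ℝ) / 27 := by
    have h3 : P.MV / (n + 2) ^ 3 ≤ P.MV / 27 :=
      Nat.div_le_div_left (le_trans (by norm_num) (Nat.pow_le_pow_left (show 3 ≤ n + 2 by have := P.hn; omega) 3))
        (by norm_num)
    calc ((P.MV / (n + 2) ^ 3 : ℕ) : ℝ) ≤ ((P.MV / 27 : ℕ) : ℝ) := by exact_mod_cast h3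
      _ ≤ (P.MV : ℝ) / 27 := Nat.cast_div_le
  push_cast at h1
  rw [P.MV_real] at h2
  have h4 : ((4 * (P.SdG + 2) : ℕ) : ℝ) ≤ P.LgV := by exact_mod_cast P.four_SdG_le_LgV
  push_cast at h4
  have hS : (P.SdG : ℝ) ≤ P.SdN := by exact_mod_cast P.SdG_le_SdN hNq
  have hL : (2 : ℝ) ^ 25 ≤ P.LgV := by
    have := P.two_pow_le_LgV
    have h' : (2:ℕ) ^ 25 ≤ 2 ^ (n + 25) := Nat.pow_le_pow_right (by norm_num) (by omega)
    exact_mod_cast h'.trans this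
  have hn : (0 : ℝ) ≤ n := by positivity
  have hn1 : (n : ℝ) ≤ (n + 1) * P.LgV / 2 ^ 25 := by
    rw [le_div_iff₀ (by positivity)]; nlinarith
  nlinarith

end PadicG3ParN

end Summit.ABC.StewartYu
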